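import Literature.Computability.Complexity.NWQuickPRG
import HarnessLib

/-!
# The Nisan–Wigderson generator armed with a truth table, in the exponential regime
# (the table-fed twin of `NWGeneratorMachine.lean` / `NWQuickPRG.lean`)

Topic `Literature/Computability/MetaComplexity`. Toolkit for item 2 of the proof sketch of Hirahara's
Lemma 3.4 (ECCC TR21-058, p. 20: "`coNP × {U} ⊆ Avg¹_{1-n^{-c}} P` implies `pr-MA = pr-NP` [KS04]",
Köbler–Schuler 2004): Merlin guesses a truth table `ρ` that the average-case hypothesis certifies to be
hard (`AvgCaseCertifiedHardness.lean`), and Arthur's coins are replaced by the outputs of a pseudorandom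
generator ARMED WITH `ρ` — a polynomial-time `F(ρ, s)` stretching `O(log N)` seed bits into `N` bits
that fool size-`N` circuits whenever `ρ` is the table of an average-case hard function on `O(log N)`
variables (the shape `tableGenerator` of `HardnessVsRandomness.lean`, IKW 2002 Thm. 11, here in the
EXPONENTIAL regime of Nisan–Wigderson 1994, Thm. 1 / Arora–Barak 2009, Thm. 20.6–20.7 (1): seed
`O(log N)`, so that a nondeterministic polynomial-time machine can enumerate all seeds).

The tree's quick generator `NWMachine.genF a β e Q` (`NWGeneratorMachine.lean`) evaluates the hard
function by running the clocked universal machine on a FIXED code word `e` of an `E`-machine; this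
file replaces that single brick by a TABLE LOOKUP in a table read off the input, and re-runs the
identification and the fooling argument of `NWQuickPRG.lean` for an arbitrary function given by its
table:

* `NWTable.lookupF` — on `⟨u, ⟨ρ, W⟩⟩` the bit `ρ[⟦u⟧]` (`⟦u⟧` the little-endian value of `u`, the order
  of `truthTable` / `boolFunEquivFin`; `binToUnaryFn` + `bitAtFn`), `lookupF_apply`;
* `NWTable.genTF a β` — **the table-fed generator** on `⟨ρ, ⟨1^N, σ⟩⟩` (exactly the input convention
  of `tableGenerator`): the concatenation over `i < N` of the table bits at the restrictions of the seed
  `σ` to the words of the greedy design (`NWMachine.designF`, `NWMachine.resF`, reused verbatim);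
  **`genTF_mem_FP`** (ONE polynomial-time string function of table and seed), **`genTF_apply`**;
* `tableGenerator_genTF_eq` — for `ρ = truthTable f`, `f : {0,1}ⁿ → {0,1}`, `n = a t(N)`,
  `t(N) = ⌊log₂ N⌋ + 1`, the generator family `tableGenerator (genTF a β) f (2^β n) N` IS
  `nwGenerator (lexDesign n 2^β t N) f` with the seed read row by row (twin of
  `NWMachine.seedGenerator_genF_eq`);
* **`isSizePseudorandom_genTF`** — if `H_avg(f) ≥ S` with `N² ≤ S` and `2^{2t+3} ≤ S` (`a ≥ 2`,
  `β = a + 1`) then that family is `SIZE(N)`-pseudorandom (twin of `NWMachine.isSizePseudorandom_genF`,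
  Arora–Barak Lemma 20.15 via `prgAdvantage_nwGenerator_le`); and the instance used downstream,
  **`isSizePseudorandom_genTF_exp`**: block length `n = 3 d t`, hardness `H_avg(f) ≥ 2^{⌊n/d⌋} = 2^{3t}`,
  `t ≥ 3`.

Everything is proved; the only definitions are the two bricks (proof devices with value lemmas).
Nothing duplicates the tree (searched `tableGenerator`, `genTF`, `lookupF`, `table-fed`: the tree's
table generators are IKW's POLYNOMIAL-regime `IKWGen.genPad` (`IKWTableGenerator.lean`, seed `O(m⁴)`,
worst-case hardness) and the `E`-level `genF`; neither gives `O(log N)` seeds from a table).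

## References

* S. Hirahara, *Average-case hardness of NP from exponential worst-case hardness assumptions*,
  ECCC TR21-058 (2021), Lemma 3.4, proof sketch, item 2 (p. 20) [Hirahara2021].
* J. Köbler, R. Schuler, *Average-case intractability vs. worst-case intractability*, Inform. and
  Comput. 190 (2004) 1–17 [KS04 of Hirahara2021].
* N. Nisan, A. Wigderson, *Hardness vs randomness*, JCSS 49 (1994) 149–167, §2–3, Thm. 1
  [NisanWigderson1994].
* S. Arora, B. Barak, *Computational Complexity: A Modern Approach*, CUP 2009, Def. 20.12,
  Lemmas 20.14–20.15, Thm. 20.6, Remark 20.8 [AroraBarakCC2009].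
* R. Impagliazzo, V. Kabanets, A. Wigderson, JCSS 65 (2002), Thm. 11 (the shape `G_r(s) = F(r, s)`)
  [ImpagliazzoKabanetsWigderson2002].
-/

noncomputable section

namespace Literature.Computability.MetaComplexity

open _root_.Computability Polynomial Finset Complexity Complexity.Brick Complexity.Plumb Complexity.NWMachine

namespace NWTable

/-! ### Little-endian values of listed bit vectors -/

/-- The little-endian value of a listed bit vector is its `boolFunEquivFin` index (twin of
`IKWGenM.bitsToNat_ofFn`, `Complexity/IKWExtTable.lean`, not imported here). [folklore] -/
theorem bitsToNat_ofFn : ∀ {L : ℕ} (v : Fin L → Bool), bitsToNat (List.ofFn v) = (boolFunEquivFin L v).val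
  | 0, v => by simp [boolFunEquivFin]
  | L + 1, v => by
    rw [List.ofFn_succ, bitsToNat_cons, bitsToNat_ofFn]
    change (v 0).toNat + 2 * ((finFunctionFinEquiv fun i : Fin L => finTwoEquiv.symm (v i.succ)) : ℕ) =
      ((finFunctionFinEquiv fun i : Fin (L + 1) => finTwoEquiv.symm (v i)) : ℕ)
    rw [finFunctionFinEquiv_apply, finFunctionFinEquiv_apply, Fin.sum_univ_succ]
    simp only [Fin.val_zero, pow_zero, mul_one, Fin.val_succ, pow_succ]
    rw [Finset.mul_sum]
    congr 1
    · cases v 0 <;> rfl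
    · exact Finset.sum_congr rfl fun i _ => by ring

/-- **Reading a truth table at the value of a listed vector gives the function value.** [folklore] -/
theorem getD_truthTable_bitsToNat_ofFn {n : ℕ} (f : (Fin n → Bool) → Bool) (x : Fin n → Bool) :
    (truthTable f).getD (bitsToNat (List.ofFn x)) false = f x := by
  unfold truthTable
  rw [bitsToNat_ofFn, List.getD_eq_getElem _ _ (by simp)]
  simp only [List.getElem_ofFn, Fin.eta, Equiv.symm_apply_apply]

/-! ### The lookup brick -/

/-- **The lookup brick** on `⟨u, z⟩`, `z = ⟨ρ, W⟩`: the table bit `ρ[⟦u⟧]` — the position `⟦u⟧`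
(capped by `|ρ|`) laid out in unary by `binToUnaryFn` on the ruler `ρ`, then read by `bitAtFn`
(empty if `⟦u⟧ ≥ |ρ|`). [folklore] -/
def lookupF : List Bool → List Bool :=
  bitAtFn ∘ fanoutFn (binToUnaryFn ∘ fanoutFn (fstF ∘ sndF) fstF) (fstF ∘ sndF)

/-- `lookupF ∈ FP`. [folklore] -/
theorem lookupF_mem_FP : lookupF ∈ FP :=
  comp_mem_FP bitAtFn_mem_FP (fanoutFn_mem_FP
    (comp_mem_FP binToUnaryFn_mem_FP (fanoutFn_mem_FP (comp_mem_FP fstF_mem_FP sndF_mem_FP) fstF_mem_FP))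
    (comp_mem_FP fstF_mem_FP sndF_mem_FP))

/-- The lookup brick is at most one symbol long on every input. [folklore] -/
theorem length_lookupF_le (z : List Bool) : (lookupF z).length ≤ 1 := by
  simp only [lookupF, Function.comp_apply, fanoutFn_apply, bitAtFn_boolPair]
  exact List.length_take_le _ _

/-- **Value of the lookup brick** inside the table: `lookupF ⟨u, ⟨ρ, W⟩⟩ = [ρ[⟦u⟧]]` when `⟦u⟧ < |ρ|`.
[folklore] -/
theorem lookupF_apply {u ρ : List Bool} (W : List Bool) (h : bitsToNat u < ρ.length) :
    lookupF (boolPair u (boolPair ρ W)) = [ρ.getD (bitsToNat u) false] := by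
  simp only [lookupF, Function.comp_apply, fanoutFn_apply, fstF_boolPair, sndF_boolPair, binToUnaryFn_boolPair,
    min_eq_left h.le]
  rw [bitAtFn_boolPair_of_lt _ _ (by simpa [ones] using h), List.getD_eq_getElem _ _ h]
  simp [ones]

/-! ### The table-fed generator -/

variable (a β : ℕ)

/-- The output piece on `⟨z, 1ⁱ⟩`, `z = ⟨ρ, W⟩`, `W = ⟨1^N, σ⟩`: the table bit at the restriction of the
seed to the `i`-th design word (the `outPieceF` of `NWGeneratorMachine.lean` with the universal
machine replaced by the lookup). [cite: AroraBarakCC2009, Def. 20.12] -/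
def outPieceTF : List Bool → List Bool := fun p =>
  lookupF (boolPair
    (resF a β (boolPair (HashBricks.nthItemFn (boolPair (sndF p) (designF a β (sndF (fstF p))))) (sndF (fstF p))))
    (fstF p))

/-- Pointwise pairing of two `FP` functions is in `FP` (`fanoutFn`, stated for the lambda; twin of
`pair_mem_FP` of `Cryptography/PRGStretchExtension.lean`, not imported here). [folklore] -/
theorem pairF_mem_FP {f g : List Bool → List Bool} (hf : f ∈ FP) (hg : g ∈ FP) :
    (fun z => boolPair (f z) (g z)) ∈ FP := by
  have h : (fun z => boolPair (f z) (g z)) = fanoutFn f g := funext fun z => (fanoutFn_apply f g z).symm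
  rw [h]
  exact fanoutFn_mem_FP hf hg

/-- Pointwise composition of two `FP` functions is in `FP` (twin of `comp_mem_FP'` of
`Cryptography/PRGStretchExtension.lean`). [folklore] -/
theorem compF_mem_FP {f g : List Bool → List Bool} (hg : g ∈ FP) (hf : f ∈ FP) :
    (fun z => g (f z)) ∈ FP :=
  comp_mem_FP hg hf

/-- `outPieceTF ∈ FP`. [folklore] -/
theorem outPieceTF_mem_FP : outPieceTF a β ∈ FP := by
  have h1 : (fun p => designF a β (sndF (fstF p))) ∈ FP :=
    compF_mem_FP (g := designF a β) (designF_mem_FP a β) (compF_mem_FP (g := sndF) sndF_mem_FP fstF_mem_FP)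
  have h2 : (fun p => HashBricks.nthItemFn (boolPair (sndF p) (designF a β (sndF (fstF p))))) ∈ FP :=
    compF_mem_FP (g := HashBricks.nthItemFn) HashBricks.nthItemFn_mem_FP (pairF_mem_FP sndF_mem_FP h1)
  have h3 : (fun p => resF a β (boolPair (HashBricks.nthItemFn (boolPair (sndF p) (designF a β (sndF (fstF p)))))
      (sndF (fstF p)))) ∈ FP :=
    compF_mem_FP (g := resF a β) (resF_mem_FP a β)
      (pairF_mem_FP h2 (compF_mem_FP (g := sndF) sndF_mem_FP fstF_mem_FP))
  exact compF_mem_FP (g := lookupF) lookupF_mem_FP (pairF_mem_FP h3 fstF_mem_FP)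

/-- The output piece is at most one symbol long on every input. [folklore] -/
theorem length_outPieceTF_le (z : List Bool) : (outPieceTF a β z).length ≤ 1 :=
  length_lookupF_le _

/-- **Value of the output piece** on `⟨⟨ρ, ⟨1^N, σ⟩⟩, 1ⁱ⟩`: the lookup at the restriction of the seed to
the `i`-th design word. [folklore] -/
theorem outPieceTF_apply (ρ σ : List Bool) (N i : ℕ) :
    outPieceTF a β (boolPair (boolPair ρ (boolPair (ones N) σ)) (ones i)) =
      lookupF (boolPair (resStr β (a * tOf N) ((designStrs a β (tOf N)).getD i []) σ)
        (boolPair ρ (boolPair (ones N) σ))) := by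
  have e1 : (ones N).length = N := List.length_replicate ..
  unfold outPieceTF
  simp only [fstF_boolPair, sndF_boolPair]
  rw [designF_apply, fstF_boolPair, e1, nthItemFn_encList, resF_apply]

/-- **The table-fed Nisan–Wigderson generator as a string function**: on `⟨ρ, ⟨1^N, σ⟩⟩`, the `N`
table bits at the restrictions of the seed `σ` to the words of the greedy design, concatenated
(the input convention of `tableGenerator`, `HardnessVsRandomness.lean`).
[cite: AroraBarakCC2009, Def. 20.12 and the proof of Thm. 20.6] [cite: ImpagliazzoKabanetsWigderson2002, Thm. 11 (the shape `F(r, s)`)] -/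
def genTF : List Bool → List Bool :=
  sndPow 2 ∘ foldLoop appF (clipF 1 (outPieceTF a β)) X ∘
    fanoutFn (fun w => w) (fanoutFn (lenBinF ∘ fstF ∘ sndF) fun _ => boolPair [] [])

/-- **The table-fed generator is polynomial time** in `|⟨ρ, ⟨1^N, σ⟩⟩|` (Nisan–Wigderson 1994, §2:
the generator runs in time exponential in the seed length, here `2^{O(ℓ)} = poly(N)`, given the
table). [cite: NisanWigderson1994, §2] -/
theorem genTF_mem_FP : genTF a β ∈ FP :=
  comp_mem_FP (sndPow_mem_FP 2) (comp_mem_FP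
    (foldLoop_clipF_mem_FP 1 appF_mem_FP length_appF_le (outPieceTF_mem_FP a β) _)
    (fanoutFn_mem_FP (PolyTimeComputable.id _)
      (fanoutFn_mem_FP (comp_mem_FP lenBinF_mem_FP (comp_mem_FP fstF_mem_FP sndF_mem_FP)) (const_mem_FP _))))

/-- The value of a restriction is below `2^{n}`, `n = a t(N)` (it has at most `n` symbols). [folklore] -/
theorem bitsToNat_resStr_lt (n : ℕ) (g σ : List Bool) : bitsToNat (resStr β n g σ) < 2 ^ n :=
  lt_of_lt_of_le (bitsToNat_lt _) (Nat.pow_le_pow_right (by norm_num) (length_resStr_le β n g σ))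

/-- **Value of the table-fed generator** on `⟨ρ, ⟨1^N, σ⟩⟩` for a table of length `≥ 2ⁿ`,
`n = a t(N)`: the concatenation of the bits `ρ[⟦uᵢ⟧]`, `uᵢ = resStr β n gᵢ σ` the restriction of the
seed to the `i`-th word of `designStrs a β t(N)`. [folklore] -/
theorem genTF_apply (ρ σ : List Bool) (N : ℕ) (hρ : 2 ^ (a * tOf N) ≤ ρ.length) :
    genTF a β (boolPair ρ (boolPair (ones N) σ)) =
      ccat (fun i => [ρ.getD (bitsToNat (resStr β (a * tOf N) ((designStrs a β (tOf N)).getD i []) σ)) false]) N := by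
  have hk : (ones N).length ≤ X.eval (boolPair ρ (boolPair (ones N) σ)).length := by
    simp only [eval_X, length_boolPair, ones, List.length_replicate]; omega
  simp only [genTF, Function.comp_apply, fanoutFn_apply, fstF_boolPair, sndF_boolPair, lenBinF_apply]
  rw [show boolPair ([] : List Bool) [] = boolPair (ones 0) [] by rfl,
    foldLoop_apply appF _ hk 0 [], sndPow_succ_boolPair, sndPow_succ_boolPair, sndPow_zero_boolPair,
    foldAcc_clipF (fun j _ _ => (length_outPieceTF_le a β _).trans (by omega)), foldAcc_appF]
  rw [List.nil_append]
  have e1 : (ones N).length = N := List.length_replicate ..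
  rw [e1]
  refine ccat_congr fun i _ => ?_
  rw [zero_add, outPieceTF_apply]
  exact lookupF_apply _ (lt_of_lt_of_le (bitsToNat_resStr_lt β _ _ _) hρ)

/-! ### Identification with `NW^f` on the greedy design -/

/-- **The table-fed generator family is the NW generator of the tabulated function**: with the seed
`s ∈ {0,1}ᵏ`, `k = 2^β n`, read as `z : [n] × [2^β] → {0,1}` row by row, output bit `i < N` of
`tableGenerator (genTF a β) f k N` is `f(z|_{block gᵢ})`, i.e. `nwGenerator (lexDesign n 2^β t N) f`
(twin of `NWMachine.seedGenerator_genF_eq`). [cite: AroraBarakCC2009, Def. 20.12] -/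
theorem tableGenerator_genTF_eq {a β N k : ℕ} (f : (Fin (a * tOf N) → Bool) → Bool)
    (hk : k = a * tOf N * 2 ^ β) (h : N ≤ (lexWords (a * tOf N) (2 ^ β) (tOf N)).length) :
    tableGenerator (genTF a β) f k N = fun s =>
      nwGenerator (lexDesign (a * tOf N) (2 ^ β) (tOf N) N h) f
        (s ∘ ((finCongr hk).trans finProdFinEquiv.symm).symm) := by
  funext s i
  have hgen := genTF_apply a β (truthTable f) (List.ofFn s) N (by rw [length_truthTable])
  rw [tableGenerator_apply, OracleCompose.unaryEncodeNat_eq_replicate, show List.replicate N true = ones N from rfl,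
    hgen, ccat_eq_ofFn _ (fun i : Fin N =>
      (truthTable f).getD (bitsToNat (resStr β (a * tOf N) ((designStrs a β (tOf N)).getD i []) (List.ofFn s))) false)
      (fun _ => rfl),
    List.getD_eq_getElem?_getD, List.getElem?_ofFn]
  simp only [Fin.is_lt, ↓reduceDIte, Option.getD_some]
  rw [getD_designStrs h i, resStr_wordStr _ _ (by rw [List.length_ofFn, hk]; exact le_of_eq (by ring)),
    getD_truthTable_bitsToNat_ofFn, nwGenerator_apply, lexDesign]
  congr 1
  funext k'
  have hlt : 2 ^ β * (k' : ℕ) + (lexDesignWords (a * tOf N) (2 ^ β) (tOf N) N h i k' : ℕ) < k := by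
    have h1 := (lexDesignWords (a * tOf N) (2 ^ β) (tOf N) N h i k').isLt
    have h2 : 2 ^ β * ((k' : ℕ) + 1) ≤ 2 ^ β * (a * tOf N) := Nat.mul_le_mul_left _ k'.isLt
    have h3 : 2 ^ β * ((k' : ℕ) + 1) = 2 ^ β * (k' : ℕ) + 2 ^ β := by ring
    rw [hk]
    nlinarith
  rw [List.getD_eq_getElem?_getD, List.getElem?_ofFn, dif_pos hlt, Option.getD_some, Function.comp_apply,
    graphBlock_apply]
  congr 1
  apply Fin.ext
  simp only [Equiv.symm_trans_apply, Equiv.symm_symm, finCongr_symm, finCongr_apply, Fin.val_cast,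
    finProdFinEquiv_apply_val]
  ring

/-! ### Fooling -/

/-- **Fooling at one output length, from an average-case hard TABLE** (Arora–Barak 2009, Thm. 20.6 /
Lemma 20.15 in the regime of Thm. 20.7 (1), for a function given by its truth table): if
`f : {0,1}ⁿ → {0,1}`, `n = a t(N)`, has `H_avg(f) ≥ S` with `N² ≤ S` and `2^{2t+3} ≤ S` (`a ≥ 2`,
`β = a + 1`), then `tableGenerator (genTF a β) f (2^β n) N` is `SIZE(N)`-pseudorandom (twin of
`NWMachine.isSizePseudorandom_genF`). [cite: AroraBarakCC2009, Thm. 20.6 and Lemma 20.15]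
[cite: NisanWigderson1994, Thm. 1] -/
theorem isSizePseudorandom_genTF {a β : ℕ} (ha : 2 ≤ a) (hβ : β = a + 1) {N : ℕ} (hN : 0 < N)
    (f : (Fin (a * tOf N) → Bool) → Bool) {S : ℝ} (hhard : AvgHardAtLeast f S)
    (hS1 : (N : ℝ) * N ≤ S) (hS2 : (2 : ℝ) ^ (2 * tOf N + 3) ≤ S) {k : ℕ} (hk : k = a * tOf N * 2 ^ β) :
    IsSizePseudorandom (tableGenerator (genTF a β) f k N) := by
  subst hβ
  have h := le_length_lexWords_param (N := N) ha
  rw [tableGenerator_genTF_eq f hk h]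
  intro C hB hs
  have hN' : (0 : ℝ) < N := Nat.cast_pos.2 hN
  refine prgAdvantage_nwGenerator_le _ _ (isNWDesign_lexDesign h) hhard hN (ε := 1 / N) ?_ _ C hB ?_
  · rw [one_div, inv_mul_eq_div, le_div_iff₀ hN']
    exact hS1
  · refine le_trans ?_ hS2
    have hu := univBound_add_four_le (tOf N)
    have hNt := lt_two_pow_tOf N
    have h1 : C.size + N * univBound (tOf N) + 2 ≤ 2 ^ (2 * tOf N + 3) := by
      have h2 : N * univBound (tOf N) ≤ 2 ^ tOf N * (5 * 2 ^ tOf N) :=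
        Nat.mul_le_mul hNt.le (by omega)
      have h3 : 2 ^ (2 * tOf N + 3) = 8 * (2 ^ tOf N * 2 ^ tOf N) := by
        rw [pow_add, two_mul, pow_add]; ring
      have h4 : 1 ≤ 2 ^ tOf N := Nat.one_le_two_pow
      nlinarith
    exact_mod_cast h1

/-- **The instance used for `pr-MA ⊆ pr-NP`**: block length `n = 3 d t(N)` (`d ≥ 1`), a table of an
`n`-variable function with `H_avg(f) ≥ 2^{⌊n/d⌋}` (`= 2^{3t}`), and `t(N) ≥ 3`; then
`tableGenerator (genTF (3d) (3d+1)) f (2^{3d+1} n) N` is `SIZE(N)`-pseudorandom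
(`2^{3t} ≥ 2^{2t+3}` and `N² < 2^{2t} ≤ 2^{3t}`). [cite: AroraBarakCC2009, Thm. 20.6, Remark 20.8] -/
theorem isSizePseudorandom_genTF_exp {d : ℕ} (hd : 1 ≤ d) {N : ℕ} (ht : 3 ≤ tOf N)
    (f : (Fin (3 * d * tOf N) → Bool) → Bool)
    (hhard : AvgHardAtLeast f ((2 : ℝ) ^ (3 * d * tOf N / d))) {k : ℕ} (hk : k = 3 * d * tOf N * 2 ^ (3 * d + 1)) :
    IsSizePseudorandom (tableGenerator (genTF (3 * d) (3 * d + 1)) f k N) := by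
  have hN : 0 < N := by
    by_contra h0
    have : N = 0 := by omega
    subst this
    simp [tOf] at ht
  have hdiv : 3 * d * tOf N / d = 3 * tOf N := by
    rw [show 3 * d * tOf N = d * (3 * tOf N) by ring, Nat.mul_div_cancel_left _ (by omega)]
  rw [hdiv] at hhard
  have hS2 : (2 : ℝ) ^ (2 * tOf N + 3) ≤ (2 : ℝ) ^ (3 * tOf N) :=
    pow_le_pow_right₀ (by norm_num) (by omega)
  have hS1 : (N : ℝ) * N ≤ (2 : ℝ) ^ (3 * tOf N) := by
    refine le_trans ?_ hS2
    have h1 : N * N < 2 ^ (2 * tOf N + 3) := by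
      have := lt_two_pow_tOf N
      have h2 : N * N < 2 ^ tOf N * 2 ^ tOf N := Nat.mul_lt_mul'' this this
      have h3 : 2 ^ tOf N * 2 ^ tOf N ≤ 2 ^ (2 * tOf N + 3) := by
        rw [← pow_add]; exact Nat.pow_le_pow_right (by norm_num) (by omega)
      omega
    exact_mod_cast h1.le
  exact isSizePseudorandom_genTF (a := 3 * d) (by omega) rfl hN f hhard hS1 hS2 hk

end NWTable

end Literature.Computability.MetaComplexity

end
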